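/-
Copyright (c) 2026 the pub-hodgecm-mathlib formalisation cell (harness21).  Prover seat hodgecm-mathlib-K2Liu-p01 (g2): Track B «K2-LIT»,
#184♮ = hLiu418 = stmt-HodgeConjecture-24832, STEWARD of socket #41 `sig_K2LiuSiegelEisensteinContinuation`; organ O41.5 (Gindikin–Karpelevich),
ROADMAP `K2/K2Liu-p01/g2/ROADMAP-O41_5-GindikinKarpelevich.K2Liup01g2.md` a6873eb1b770b760, sub-organ O41.5b in MATRIX form (all ranks `n`).
-/
import Literature.NumberTheory.GelbartRogawski1991.LocalDoubledUnitaryUnramifiedCell   -- ★ `nElem`, `weylDelta`, `IsIntegralAt`, `apply_mem_glInt_of_isIntegralAt`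
import Literature.NumberTheory.K2Lit.LocalSiegelIntertwining                          -- ★ D10 `IsSphericalSection`
import HarnessLib

/-!
# Crux `HLiu418`, road `K2_Liu`, socket #41, organ O41.5b (matrix form): THE IWASAWA FACTORISATION OF `w_Δ · n(X)` FOR INVERTIBLE `X`
# and the value of a spherical section on the big cell

Cell `hodgecm-mathlib`, crux item hLiu418 = `stmt-HodgeConjecture-24832`; squad K2 ∕ K2Liu; prover K2Liu-p01 (g2), steward of #41.
THEOREMS ONLY (no `def`, no instance, no notation, no named-fact hypothesis, no `sorry`); lane `--supports stmt-HodgeConjecture-24832`.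

THE IDENTITY.  In the `Δ`-adapted frame of `H(F_v) = U(T₀ ⊕ −T₀)(F_v)` (★ `adapt ∘ matA`), `w_Δ ↦ s = (0 1; 1 0)` and `n(X) ↦ (1 X; 0 1)` for a
`T₀`-skew `X` over `E ⊗ F_v` (★ `weylDelta`, ★ `nElem`).  If `X` is INVERTIBLE, then
  `s · (1 X; 0 1) = (0 1; 1 X) = (−X⁻¹ 1; 0 X) · (1 0; X⁻¹ 1)`,   `(1 0; X⁻¹ 1) = s (1 X⁻¹; 0 1) s`,
i.e. **`w_Δ · n(X) = p(X) · k(X)`** with `p(X) := w_Δ n(X) w_Δ n(−X⁻¹) w_Δ ∈ P_Δ(F_v)` (adapted matrix `(−X⁻¹ 1; 0 X)`: `C = 0`, Levi part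
`(−X⁻¹, X)`) and `k(X) := w_Δ n(X⁻¹) w_Δ`, which lies in `K_v = H(𝒪_v)` as soon as `X⁻¹` is integral and `|2|_w = 1` (all `w ∣ v`).  Hence for every
SPHERICAL section `φ` of `I_v(s, χ_v)` (★ D10 `IsSphericalSection`):  **`φ(w_Δ n(X)) = localSiegelCharacter χ_v s (p(X))`** (= `χ_v(det(−X⁻¹))·|det X|_v^{−(s+n/2)}`),
and `φ(w_Δ n(X)) = 1` when `X` itself is integral (then `w_Δ n(X) ∈ K_v`).  At `n = 1` these two facts ARE the rank-one Gindikin–Karpelevich integrand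
`(max 1 ‖x‖)^{−(2s+1)}` of ★ `K2LiuGKRankOneIntegral`; at `n = 2` they are the tool for each step of the peeling along `w_Δ = s_{α₂}s_{α₁}s_{α₂}` (ROADMAP O41.5d).
[Casselman1980, §3] [GelbartPiatetskishapiroRallis1987, Part A §5] [Kudla1994, §3] [HarrisKudlaSweet1996, §1 (1.11)–(1.12)].
HONEST LABEL.  Count-neutral helper; it retires nothing by itself: `HC_CM` is proved only modulo the 7 printed citations (2 remaining named inputs:
hLiu418 = `stmt-HodgeConjecture-24832`, h413 = `stmt-HodgeConjecture-24833`) until rung 0 closes.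

## References
* [Casselman1980] W. Casselman, Compositio Math. 40 (1980): §3.
* [GelbartPiatetskishapiroRallis1987] S. Gelbart, I. Piatetski-Shapiro, S. Rallis, LNM 1254 (1987), Part A §5.
* [Kudla1994] S. S. Kudla, Israel J. Math. 87 (1994): §3.   * [HarrisKudlaSweet1996] M. Harris, S. Kudla, W. J. Sweet, J. AMS 9 (1996): §1 (1.11)–(1.12).
-/

set_option autoImplicit false
set_option linter.dupNamespace false -- the mandated namespace repeats `HodgeConjecture.HodgeConjecture`

noncomputable section

open NumberField IsDedekindDomain Matrix
open scoped ValuativeRel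
open Literature.NumberTheory.Automorphic Literature.NumberTheory.Automorphic.UnitaryGroup
open Literature.NumberTheory.GelbartRogawski1991.AdaptedBlocks
open Literature.NumberTheory.GelbartRogawski1991.UnitaryDualPair.LocalSplitting
open Literature.NumberTheory.K2Lit.LocalSiegelDoubled

namespace Summit.HodgeConjecture.HodgeConjecture.Cruxes.HLiu418.K2LiuSiegelWeylUnipotentIwasawa

/-! ## §1 Skewness of `X⁻¹` -/

section Skew

variable {L : Type*} [CommRing L] {ι : Type*} [Fintype ι] [DecidableEq ι]

/-- `(M⁻¹).map σ = (M.map σ)⁻¹` for a ring hom `σ` when `det M` is a unit. [folklore] -/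
theorem map_nonsing_inv_of_isUnit {L' : Type*} [CommRing L'] (σ : L →+* L') {M : Matrix ι ι L} (hM : IsUnit M.det) :
    (M⁻¹).map σ = (M.map σ)⁻¹ := by
  refine (Matrix.inv_eq_left_inv ?_).symm
  rw [← Matrix.map_mul, Matrix.nonsing_inv_mul M hM, Matrix.map_one σ (map_zero σ) (map_one σ)]

/-- **if `X` is `T`-skew (`σ(X)ᵀ T + T X = 0`) and invertible, so is `X⁻¹`.** [cite: Kudla1994, §3] -/
theorem skew_inv (σ : L →+* L) {T X : Matrix ι ι L} (hX : IsUnit X.det) (h : (X.map σ)ᵀ * T + T * X = 0) :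
    ((X⁻¹).map σ)ᵀ * T + T * X⁻¹ = 0 := by
  have hXσ : IsUnit (X.map σ).det := by rw [← RingHom.mapMatrix_apply, ← RingHom.map_det]; exact hX.map _
  have hXσT : IsUnit (X.map σ)ᵀ.det := by rwa [Matrix.det_transpose]
  rw [map_nonsing_inv_of_isUnit σ hX, Matrix.transpose_nonsing_inv]
  -- `A T = −T X` with `A = σ(X)ᵀ`; multiply by `A⁻¹` on the left and `X⁻¹` on the right
  have h1 : (X.map σ)ᵀ * T = -(T * X) := eq_neg_of_add_eq_zero_left h
  have h2 : T * X⁻¹ = -(((X.map σ)ᵀ)⁻¹ * T) := by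
    calc T * X⁻¹ = ((X.map σ)ᵀ)⁻¹ * ((X.map σ)ᵀ * T) * X⁻¹ := by
            rw [← Matrix.mul_assoc, Matrix.nonsing_inv_mul _ hXσT, Matrix.one_mul]
      _ = -(((X.map σ)ᵀ)⁻¹ * (T * (X * X⁻¹))) := by
            rw [h1, Matrix.mul_neg, Matrix.neg_mul]; simp only [Matrix.mul_assoc]
      _ = -(((X.map σ)ᵀ)⁻¹ * T) := by rw [Matrix.mul_nonsing_inv _ hX, Matrix.mul_one]
  rw [h2, add_neg_cancel]

end Skew

/-! ## §2 The factorisation `w_Δ n(X) = p(X) k(X)` in `H(F_v)` -/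

section Local

variable (F : Type) [Field F] [NumberField F] (E : Type) [Field E] [NumberField E] [Algebra F E]
  [Algebra.IsQuadraticExtension F E] (c : E ≃ₐ[F] E)
  {δ : E} (hcδ : c δ = -δ) (hδ : δ ≠ 0) {d : F} (hd : δ * δ = algebraMap F E d)
  (v : HeightOneSpectrum (𝓞 F)) (n : ℕ) {T₀ : Matrix (Fin n) (Fin n) F} (hT₀ : T₀.IsSymm)
  {JD : Matrix (Fin (n + n)) (Fin (n + n)) E} (hJD : JD = (gramD F n T₀).map (algebraMap F E))

omit [Algebra.IsQuadraticExtension F E] in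
include hJD in
/-- **`w_Δ n(X) = p(X) · k(X)`** with `p(X) = w_Δ n(X) w_Δ n(−X⁻¹) w_Δ` and `k(X) = w_Δ n(X⁻¹) w_Δ` (group identity: `w_Δ² = 1`, `n(−Y) n(Y) = 1`).
[cite: Kudla1994, §3] [cite: Casselman1980, §3] -/
theorem weylDelta_mul_nElem_eq (X : Matrix (Fin n) (Fin n) (LocalRing E v))
    (hX : (X.map (conjLocal E c v))ᵀ * gramS F E v n T₀ + gramS F E v n T₀ * X = 0) (hXu : IsUnit X.det)
    (hXi : ((X⁻¹).map (conjLocal E c v))ᵀ * gramS F E v n T₀ + gramS F E v n T₀ * X⁻¹ = 0)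
    (hXn : ((-X⁻¹).map (conjLocal E c v))ᵀ * gramS F E v n T₀ + gramS F E v n T₀ * (-X⁻¹) = 0) :
    weylDelta F E c v n hJD * nElem F E c v n hJD X hX =
      (weylDelta F E c v n hJD * nElem F E c v n hJD X hX * weylDelta F E c v n hJD *
          nElem F E c v n hJD (-X⁻¹) hXn * weylDelta F E c v n hJD) *
        (weylDelta F E c v n hJD * nElem F E c v n hJD X⁻¹ hXi * weylDelta F E c v n hJD) := by
  have hw := weylDelta_mul_self F E c v n hJD (T₀ := T₀)
  have hn : nElem F E c v n hJD (-X⁻¹) hXn *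
      nElem F E c v n hJD X⁻¹ hXi = 1 := by
    rw [← nElem_inv F E c v n hJD X⁻¹ (skew_inv (conjLocal E c v) hXu hX), inv_mul_cancel]
  simp only [mul_assoc]
  rw [← mul_assoc (weylDelta F E c v n hJD) (weylDelta F E c v n hJD), hw, one_mul, ← mul_assoc (nElem F E c v n hJD (-X⁻¹) _), hn, one_mul, hw,
    mul_one]

omit [Algebra.IsQuadraticExtension F E] in
include hJD in
/-- **the adapted matrix of `p(X)` is `(−X⁻¹ 1; 0 X)`** (`s(1 X;0 1)s = (1 0; X 1)`, times `(1 −X⁻¹; 0 1)`, times `s`).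
[cite: Kudla1994, §3] [cite: HarrisKudlaSweet1996, §1 (1.12)] -/
theorem adapt_matA_pElem (X : Matrix (Fin n) (Fin n) (LocalRing E v))
    (hX : (X.map (conjLocal E c v))ᵀ * gramS F E v n T₀ + gramS F E v n T₀ * X = 0) (hXu : IsUnit X.det)
    (hXn : ((-X⁻¹).map (conjLocal E c v))ᵀ * gramS F E v n T₀ + gramS F E v n T₀ * (-X⁻¹) = 0) :
    adapt (matA F E c v n (weylDelta F E c v n hJD * nElem F E c v n hJD X hX * weylDelta F E c v n hJD *
        nElem F E c v n hJD (-X⁻¹) hXn * weylDelta F E c v n hJD)) =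
      Matrix.fromBlocks (-X⁻¹) 1 0 X := by
  rw [← matA_mul, ← matA_mul, ← matA_mul, ← matA_mul, adapt_mul, adapt_mul, adapt_mul, adapt_mul, weylDelta, adapt_matA_ofAdapted,
    adapt_matA_nElem, adapt_matA_nElem]
  simp only [Matrix.fromBlocks_multiply, Matrix.one_mul, Matrix.mul_one, Matrix.zero_mul, Matrix.mul_zero, zero_add, add_zero, Matrix.mul_neg,
    Matrix.mul_nonsing_inv X hXu, neg_add_cancel]

include hcδ hδ hd hT₀ hJD in
/-- **`p(X) ∈ P_Δ(F_v)`** (`C = 0`). [cite: Kudla1994, §3] -/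
theorem isSiegelDelta_pElem (X : Matrix (Fin n) (Fin n) (LocalRing E v))
    (hX : (X.map (conjLocal E c v))ᵀ * gramS F E v n T₀ + gramS F E v n T₀ * X = 0) (hXu : IsUnit X.det)
    (hXn : ((-X⁻¹).map (conjLocal E c v))ᵀ * gramS F E v n T₀ + gramS F E v n T₀ * (-X⁻¹) = 0) :
    IsSiegelDelta F E c hcδ hδ hd v n hT₀ hJD (weylDelta F E c v n hJD * nElem F E c v n hJD X hX * weylDelta F E c v n hJD *
        nElem F E c v n hJD (-X⁻¹) hXn * weylDelta F E c v n hJD) := by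
  rw [isSiegelDelta_iff_blkC_eq_zero F E c hcδ hδ hd v n hT₀ hJD, blkC_eq_toBlocks₂₁_adapt, adapt_matA_pElem F E c v n hJD X hX hXu hXn,
    Matrix.toBlocks_fromBlocks₂₁]

omit [Algebra.IsQuadraticExtension F E] in
include hJD in
/-- **the `Δ`-block of `p(X)` over `E ⊗ F_v` is `−X⁻¹`** (`A + C` with `C = 0`). [cite: Kudla1994, §3] -/
theorem toBlocks_add_matA_pElem (X : Matrix (Fin n) (Fin n) (LocalRing E v))
    (hX : (X.map (conjLocal E c v))ᵀ * gramS F E v n T₀ + gramS F E v n T₀ * X = 0) (hXu : IsUnit X.det)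
    (hXn : ((-X⁻¹).map (conjLocal E c v))ᵀ * gramS F E v n T₀ + gramS F E v n T₀ * (-X⁻¹) = 0) :
    (matA F E c v n (weylDelta F E c v n hJD * nElem F E c v n hJD X hX * weylDelta F E c v n hJD *
        nElem F E c v n hJD (-X⁻¹) hXn * weylDelta F E c v n hJD)).toBlocks₁₁ +
      (matA F E c v n (weylDelta F E c v n hJD * nElem F E c v n hJD X hX * weylDelta F E c v n hJD *
        nElem F E c v n hJD (-X⁻¹) hXn * weylDelta F E c v n hJD)).toBlocks₁₂ = -X⁻¹ := by
  have h := adapt_matA_pElem F E c v n hJD X hX hXu hXn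
  rw [adapt_eq] at h
  obtain ⟨hA, -, hC, -⟩ := Matrix.fromBlocks_inj.1 h
  rw [← blkA_add_blkC, hA, hC, add_zero]

omit [Algebra.IsQuadraticExtension F E] in
include hJD in
/-- **`det_Δ p(X)_w = det(−X⁻¹)_w`** at every place `w ∣ v`. [cite: Kudla1994, §3] [cite: HarrisKudlaSweet1996, §1 (1.15)] -/
theorem detDelta_pElem (X : Matrix (Fin n) (Fin n) (LocalRing E v))
    (hX : (X.map (conjLocal E c v))ᵀ * gramS F E v n T₀ + gramS F E v n T₀ * X = 0) (hXu : IsUnit X.det)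
    (hXn : ((-X⁻¹).map (conjLocal E c v))ᵀ * gramS F E v n T₀ + gramS F E v n T₀ * (-X⁻¹) = 0) (w : PlacesOver E v) :
    detDelta F E c v n w (weylDelta F E c v n hJD * nElem F E c v n hJD X hX * weylDelta F E c v n hJD *
        nElem F E c v n hJD (-X⁻¹) hXn * weylDelta F E c v n hJD) = (-X⁻¹).det w := by
  rw [← det_deltaBlockS_apply F E c v n _ w]
  exact congrArg (fun M : Matrix (Fin n) (Fin n) (LocalRing E v) => M.det w) (toBlocks_add_matA_pElem F E c v n hJD X hX hXu hXn)

/-! ## §3 Integrality: `k(X) ∈ K_v` when `X⁻¹` is integral, `w_Δ n(X) ∈ K_v` when `X` is integral -/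

omit [Algebra.IsQuadraticExtension F E] in
include hJD in
/-- the adapted matrix of `w_Δ` is integral. [cite: GelbartRogawski1991, §3.1 (3.1.3)] -/
theorem isIntegralAt_matA_weylDelta (w : PlacesOver E v) (h2 : ValuativeRel.valuation (w.1.adicCompletion E) (2 : w.1.adicCompletion E) = 1) :
    IsIntegralAt F E v w (matA F E c v n (weylDelta F E c v n hJD (T₀ := T₀))) := by
  have h1 : ∀ i j : Fin n, ValuativeRel.valuation (w.1.adicCompletion E) ((1 : Matrix (Fin n) (Fin n) (LocalRing E v)) i j w) ≤ 1 := by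
    intro i j
    by_cases h : i = j
    · subst h; simp
    · simp [Matrix.one_apply_ne h]
  rw [weylDelta, matA_ofAdapted]
  exact isIntegralAt_conj F E v n w h2 (IsIntegralAt.fromBlocks IsIntegralAt.zero h1 h1 IsIntegralAt.zero)

omit [Algebra.IsQuadraticExtension F E] in
include hJD in
/-- **`w_Δ n(Y) w_Δ ∈ K_v`** when `Y` is integral at every `w ∣ v` and `|2|_w = 1` (any finite `v`, split or not). [cite: GelbartRogawski1991, §3.1 (3.1.3)] -/
theorem weylDelta_mul_nElem_mul_weylDelta_mem_localInt (Y : Matrix (Fin n) (Fin n) (LocalRing E v))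
    (hY : (Y.map (conjLocal E c v))ᵀ * gramS F E v n T₀ + gramS F E v n T₀ * Y = 0)
    (h2 : ∀ w : PlacesOver E v, ValuativeRel.valuation (w.1.adicCompletion E) (2 : w.1.adicCompletion E) = 1)
    (hYi : ∀ w : PlacesOver E v, IsIntegralAt F E v w Y) :
    weylDelta F E c v n hJD * nElem F E c v n hJD Y hY * weylDelta F E c v n hJD ∈ UnitaryGroup.localInt E c (n + n) JD v := by
  rw [UnitaryGroup.mem_localInt_iff]
  intro w
  have hw := isIntegralAt_matA_weylDelta F E c v n hJD (T₀ := T₀) w (h2 w)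
  refine apply_mem_glInt_of_isIntegralAt F E c v n w _ ?_ ?_
  · rw [← matA_mul, ← matA_mul]
    exact (hw.mul (isIntegralAt_matA_nElem F E c v n hJD w (h2 w) hY (hYi w))).mul hw
  · rw [_root_.mul_inv_rev, _root_.mul_inv_rev, weylDelta_inv, nElem_inv, ← mul_assoc, ← matA_mul, ← matA_mul]
    exact (hw.mul (isIntegralAt_matA_nElem F E c v n hJD w (h2 w) _ (hYi w).neg)).mul hw

omit [Algebra.IsQuadraticExtension F E] in
include hJD in
/-- **`w_Δ n(X) ∈ K_v` when `X` is integral** at every `w ∣ v` and `|2|_w = 1`. [cite: GelbartRogawski1991, §3.1 (3.1.3)] -/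
theorem weylDelta_mul_nElem_mem_localInt (X : Matrix (Fin n) (Fin n) (LocalRing E v))
    (hX : (X.map (conjLocal E c v))ᵀ * gramS F E v n T₀ + gramS F E v n T₀ * X = 0)
    (h2 : ∀ w : PlacesOver E v, ValuativeRel.valuation (w.1.adicCompletion E) (2 : w.1.adicCompletion E) = 1)
    (hXi : ∀ w : PlacesOver E v, IsIntegralAt F E v w X) :
    weylDelta F E c v n hJD * nElem F E c v n hJD X hX ∈ UnitaryGroup.localInt E c (n + n) JD v := by
  rw [UnitaryGroup.mem_localInt_iff]
  intro w
  have hw := isIntegralAt_matA_weylDelta F E c v n hJD (T₀ := T₀) w (h2 w)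
  refine apply_mem_glInt_of_isIntegralAt F E c v n w _ ?_ ?_
  · rw [← matA_mul]
    exact hw.mul (isIntegralAt_matA_nElem F E c v n hJD w (h2 w) hX (hXi w))
  · rw [_root_.mul_inv_rev, weylDelta_inv, nElem_inv, ← matA_mul]
    exact (isIntegralAt_matA_nElem F E c v n hJD w (h2 w) _ (hXi w).neg).mul hw

/-! ## §4 Values of a spherical section on `w_Δ N_Δ(F_v)` -/

include hcδ hδ hd hT₀ hJD in
/-- **THE BIG-CELL VALUE OF A SPHERICAL SECTION**: for `φ` spherical in `I_v(s, χ_v)` (★ D10), `X` skew invertible with `X⁻¹` integral and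
`|2|_w = 1` at every `w ∣ v`:  `φ(w_Δ n(X)) = χ_v(det_Δ p(X))·|det_Δ p(X)|_v^{s+n/2}` with `det_Δ p(X)_w = det(−X_w⁻¹)` (`detDelta_pElem`).
At `n = 1`, `X = x`: `φ(w_Δ n(x)) = χ_w(−x⁻¹)|x|_w^{−(s+½)}` for `|x|_w ≥ 1`. [cite: Casselman1980, §3] [cite: GelbartPiatetskishapiroRallis1987, Part A §5] -/
theorem IsSphericalSection.apply_weylDelta_mul_nElem (χv : ∀ w : PlacesOver E v, (w.1.adicCompletion E)ˣ →* ℂˣ) (s : ℂ)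
    {φ : UnitaryGroup.localPi E c (n + n) JD v → ℂ} (hφ : IsSphericalSection F E c hcδ hδ hd v n hT₀ hJD χv s φ)
    (X : Matrix (Fin n) (Fin n) (LocalRing E v)) (hX : (X.map (conjLocal E c v))ᵀ * gramS F E v n T₀ + gramS F E v n T₀ * X = 0) (hXu : IsUnit X.det)
    (hXi : ((X⁻¹).map (conjLocal E c v))ᵀ * gramS F E v n T₀ + gramS F E v n T₀ * X⁻¹ = 0)
    (hXn : ((-X⁻¹).map (conjLocal E c v))ᵀ * gramS F E v n T₀ + gramS F E v n T₀ * (-X⁻¹) = 0)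
    (h2 : ∀ w : PlacesOver E v, ValuativeRel.valuation (w.1.adicCompletion E) (2 : w.1.adicCompletion E) = 1)
    (hXint : ∀ w : PlacesOver E v, IsIntegralAt F E v w X⁻¹) :
    φ (weylDelta F E c v n hJD * nElem F E c v n hJD X hX) =
      localSiegelCharacter F E c v n χv s (weylDelta F E c v n hJD * nElem F E c v n hJD X hX * weylDelta F E c v n hJD *
        nElem F E c v n hJD (-X⁻¹) hXn * weylDelta F E c v n hJD) := by
  have h := hφ.apply_siegel_mul_localInt (isSiegelDelta_pElem F E c hcδ hδ hd v n hT₀ hJD X hX hXu hXn)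
    (weylDelta_mul_nElem_mul_weylDelta_mem_localInt F E c v n hJD X⁻¹ hXi h2 hXint)
  rw [← weylDelta_mul_nElem_eq F E c v n hJD X hX hXu hXi hXn] at h
  exact h

include hcδ hδ hd hT₀ hJD in
/-- **THE SMALL-CELL VALUE**: for `φ` spherical and `X` skew INTEGRAL (with `|2|_w = 1`), `w_Δ n(X) ∈ K_v` and `φ(w_Δ n(X)) = 1`.
[cite: Casselman1980, §3] [cite: GelbartPiatetskishapiroRallis1987, Part A §5] -/
theorem IsSphericalSection.apply_weylDelta_mul_nElem_of_integral (χv : ∀ w : PlacesOver E v, (w.1.adicCompletion E)ˣ →* ℂˣ) (s : ℂ)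
    {φ : UnitaryGroup.localPi E c (n + n) JD v → ℂ} (hφ : IsSphericalSection F E c hcδ hδ hd v n hT₀ hJD χv s φ)
    (X : Matrix (Fin n) (Fin n) (LocalRing E v)) (hX : (X.map (conjLocal E c v))ᵀ * gramS F E v n T₀ + gramS F E v n T₀ * X = 0)
    (h2 : ∀ w : PlacesOver E v, ValuativeRel.valuation (w.1.adicCompletion E) (2 : w.1.adicCompletion E) = 1)
    (hXi : ∀ w : PlacesOver E v, IsIntegralAt F E v w X) :
    φ (weylDelta F E c v n hJD * nElem F E c v n hJD X hX) = 1 :=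
  hφ.apply_of_mem_localInt (weylDelta_mul_nElem_mem_localInt F E c v n hJD X hX h2 hXi)

end Local

end Summit.HodgeConjecture.HodgeConjecture.Cruxes.HLiu418.K2LiuSiegelWeylUnipotentIwasawa

end
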